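import Mathlib.Tactic.Linarith
import Mathlib.Tactic.NormNum
import Summits.Ventures.CertifiedManyBodySolver.Downfold.PhaseMapMaterialVerdict
import Summits.Ventures.CertifiedManyBodySolver.Downfold.RouterWordScore

/-!
# The §14 worked-example PASS criteria, part 1: PASS-TV1 (H₃S) and PASS-TV3 (LK-99, Cu controls) as total
# functions — the yardstick of the worked examples, kernel-stated before the runs it judges (ACCEPTANCE §6)

Venture CertifiedManyBodySolver, cell `pub/hubbard-downfold`, seat hubbard-downfold-score-2 (session g5);
namespace `Summit.Ventures.CertifiedManyBodySolver.Downfold.WorkedExample`. Everything here is PROVED and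
finite; nothing is about a material. The inputs are the quantities the two scorers of record already print
per material (router outcome, H-incident flag, material verdict kind, per-column band / INSIDE / relative
half-width, cell words); this file only COMBINES them into the PASS / FAIL words ACCEPTANCE §6.1 / §6.3 define,
exactly as the regression layer `validation/score/regression/v1/tv_criteria.py` (hubbard-downfold-score-2) does,
REUSING the second engine's kernel objects (score-1): `CellScore.Kind` / `CellScore.verdict` (§4.5,
`PhaseMapMaterialVerdict`), `CellScore.inside` / `tau` / `relevant` (§4.4, `PhaseMapCellScore`) and
`RouterScore.Outcome` (§4.2, `RouterWordScore`). Part 2 (`WorkedExamplePassDome`) does PASS-TV2.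

WHAT THIS IS NOT: not a scorer of record (deputy-2 `score.py` v1.5 831b947ed82e8932 and score-1 `phasemap.py`
1.5.0 are), not a certification of any cell, not physics, and not a new number: the two thresholds below
(relative half-width ≤ 1/4; false-high-T_c factor 5/4) are ACCEPTANCE §6.1's [v1-proposed] numbers verbatim.

* §1 PASS-TV1 (M08 H₃S): `tv1` = (a) well-formed ∧ H-clean ∧ (b) router AGREE ∧ (c) at least 2 truth-SC
  pressure columns COUNT (INSIDE ∧ relative half-width ≤ 1/4) ∧ (d) no «SC» cell above 5/4·(T_c + τ) ∧ (e)
  material verdict TP. Consequences: at most one counting column ⇒ FAIL (`tv1_eq_FAIL_of_nCounting_le_one`) —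
  so the day-0…run-#4 state of H₃S (no band of record) FAILS BY CONSTRUCTION (`tv1_h3sToday`); a band wider than
  ±25 % never counts (`Column.counts_eq_false_of_wide`); the §14 expected-shape instance passes (`tv1_h3sExpected`);
  the (d) limits on the truth of record are 266.4375 / 243.75 / 250 K (`falseHighLimit_h3s`).
* §2 PASS-TV3 (LK-99, Cu): `tv3LK99` / `tv3Cu` over the column's cells and bands through score-1's `verdict`.
  Consequences: LK-99's honest all-«undetermined» map with router AGREE PASSES (`tv3LK99_eq_PASS_of_honest`) and
  any «SC» cell fails it (`tv3LK99_eq_FAIL_of_SC_cell`); Cu's all-«undetermined» (pending:eph-band) map FAILS by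
  construction (`tv3Cu_eq_FAIL_of_all_undetermined`) and the §14 expected Cu shape passes (`tv3Cu_expected`).
-/

namespace Summit.Ventures.CertifiedManyBodySolver.Downfold

namespace WorkedExample

open CellScore

/-- The word of a PASS criterion: PASS, FAIL, or NOT-YET (no clause false, some not yet decidable; part 2). [folklore] -/
inductive Pass
  /-- every clause holds -/
  | PASS
  /-- some clause is false -/
  | FAIL
  /-- no clause is false but some clause is not yet decidable -/
  | NOT_YET
  deriving DecidableEq, Repr

/-- the constant 1/10 K (the «band decides SC» / «every T ≥ 0.1 K cell» threshold of §4.5 / §6.3). [folklore] -/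
def tenth : ℚ := 1 / 10

/-! ## §1 PASS-TV1 — M08 H₃S, P ∈ {100, 150, 200} GPa (ACCEPTANCE §6.1) -/

/-- One truth-SC pressure column of the TV1 material as scored: the map's band (if any), measured T_c, τ (§2.3). [folklore] -/
structure Column where
  /-- the map's T_c band `[lo, hi]` at this pressure; `none` if the column carries no band -/
  band : Option (ℚ × ℚ)
  /-- measured T_c of the truth column (K) -/
  Tc : ℚ
  /-- tolerance τ(T_c, err) of the truth column (K) -/
  τ : ℚ

namespace Column

/-- §4.4 INSIDE of the column (`false` without a band). [folklore] -/
def inside (c : Column) : Bool :=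
  match c.band with
  | none => false
  | some b => CellScore.inside b.1 b.2 c.Tc c.τ

/-- The column COUNTS toward PASS-TV1 (c): INSIDE ∧ relative half-width `(hi − lo)/(hi + lo)` ≤ 1/4 ([v1-proposed]
0.25: «a band wider than ±25 % is not a prediction»); no band ⇒ does not count. [folklore] -/
def counts (c : Column) : Bool :=
  match c.band with
  | none => false
  | some b => CellScore.inside b.1 b.2 c.Tc c.τ && decide ((b.2 - b.1) / (b.2 + b.1) ≤ (1 : ℚ) / 4)

/-- A band wider than ±25 % does not count, inside or not (regression scenario S02). [folklore] -/
theorem counts_eq_false_of_wide {lo hi Tc τ : ℚ} (h : (1 : ℚ) / 4 < (hi - lo) / (hi + lo)) :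
    counts ⟨some (lo, hi), Tc, τ⟩ = false := by
  show (CellScore.inside lo hi Tc τ && decide ((hi - lo) / (hi + lo) ≤ (1 : ℚ) / 4)) = false
  rw [decide_eq_false (not_le.mpr h), Bool.and_false]

/-- A band that misses the measured T_c does not count (regression scenario S01). [folklore] -/
theorem counts_eq_false_of_not_inside {lo hi Tc τ : ℚ} (h : CellScore.inside lo hi Tc τ = false) :
    counts ⟨some (lo, hi), Tc, τ⟩ = false := by
  show (CellScore.inside lo hi Tc τ && decide ((hi - lo) / (hi + lo) ≤ (1 : ℚ) / 4)) = false
  rw [h, Bool.false_and]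

/-- A counting column is INSIDE. [folklore] -/
theorem inside_of_counts {c : Column} (h : c.counts = true) : c.inside = true := by
  obtain ⟨b, Tc, τ⟩ := c
  cases b with
  | none => exact absurd h (by simp [counts])
  | some b =>
    simp only [counts, Bool.and_eq_true] at h
    simpa [inside] using h.1

end Column

/-- PASS-TV1 (d) limit «no SC cell at T > 1.25 × (T_c + τ)» of a truth-SC column. [folklore] -/
def falseHighLimit (Tc τ : ℚ) : ℚ := 5 / 4 * (Tc + τ)

/-- PASS-TV1 (d) on one column: no «SC» cell strictly above `falseHighLimit` (cells as (T, word)). [folklore] -/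
def noFalseHigh (Tc τ : ℚ) (cells : List (ℚ × Word)) : Bool :=
  cells.all fun c => !(decide (c.2 = Word.SC) && decide (falseHighLimit Tc τ < c.1))

/-- `noFalseHigh` unfolded: every «SC» cell sits at or below the limit. [folklore] -/
theorem noFalseHigh_iff {Tc τ : ℚ} {cells : List (ℚ × Word)} :
    noFalseHigh Tc τ cells = true ↔ ∀ c ∈ cells, c.2 = Word.SC → c.1 ≤ falseHighLimit Tc τ := by
  unfold noFalseHigh
  rw [List.all_eq_true]
  constructor
  · intro h c hc hsc
    have h' := h c hc
    rw [Bool.not_and, Bool.or_eq_true, Bool.not_eq_true', Bool.not_eq_true', decide_eq_false_iff_not,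
      decide_eq_false_iff_not, not_lt] at h'
    exact h'.resolve_left (fun hn => hn hsc)
  · intro h c hc
    rw [Bool.not_and, Bool.or_eq_true, Bool.not_eq_true', Bool.not_eq_true', decide_eq_false_iff_not,
      decide_eq_false_iff_not, not_lt]
    by_cases hsc : c.2 = Word.SC
    · exact Or.inr (h c hc hsc)
    · exact Or.inl hsc

/-- The TV1 material as the scorer reports it. [folklore] -/
structure TV1 where
  /-- (a) W1–W8 clean: the map was not rejected -/
  wellFormed : Bool
  /-- no H1/H2 incident names this map -/
  hClean : Bool
  /-- (b) the §4.2 router-word outcome -/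
  router : RouterScore.Outcome
  /-- the truth-SC pressure columns (100, 150, 200 GPa for H₃S) -/
  columns : List Column
  /-- (d) holds on every column (`noFalseHigh` of each) -/
  noFalseHighTc : Bool
  /-- (e) the §4.5 material verdict kind -/
  kind : Kind

/-- number of columns that COUNT toward (c). [folklore] -/
def TV1.nCounting (x : TV1) : ℕ := x.columns.countP Column.counts

/-- the PASS-TV1 conjunction (a) ∧ H-clean ∧ (b) ∧ (c) ∧ (d) ∧ (e) as a Boolean. [folklore] -/
def TV1.holds (x : TV1) : Bool :=
  x.wellFormed && x.hClean && decide (x.router = RouterScore.Outcome.AGREE) && decide (2 ≤ x.nCounting)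
    && x.noFalseHighTc && decide (x.kind = Kind.TP)

/-- PASS-TV1 (two-valued: every clause is decidable on any delivered map). [folklore] -/
def tv1 (x : TV1) : Pass := if x.holds then .PASS else .FAIL

/-- `tv1` is PASS exactly when the conjunction holds. [folklore] -/
theorem tv1_eq_PASS_iff (x : TV1) : tv1 x = .PASS ↔ x.holds = true := by
  unfold tv1; split_ifs with h <;> simp [h]

/-- The conjunction, clause by clause. [folklore] -/
theorem TV1.holds_iff (x : TV1) : x.holds = true ↔
    x.wellFormed = true ∧ x.hClean = true ∧ x.router = RouterScore.Outcome.AGREE ∧ 2 ≤ x.nCounting ∧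
      x.noFalseHighTc = true ∧ x.kind = Kind.TP := by
  simp [TV1.holds, Bool.and_eq_true, and_assoc]

/-- (a): a rejected map fails TV1 (S06/S07/S08). [folklore] -/
theorem tv1_eq_FAIL_of_not_wellFormed {x : TV1} (h : x.wellFormed = false) : tv1 x = .FAIL := by
  simp [tv1, TV1.holds, h]

/-- an H1/H2 incident on the map fails TV1 (S05: a certified T > 0 cell). [folklore] -/
theorem tv1_eq_FAIL_of_not_hClean {x : TV1} (h : x.hClean = false) : tv1 x = .FAIL := by
  simp [tv1, TV1.holds, h]

/-- (b): a router word outside the expected set fails TV1 (S04). [folklore] -/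
theorem tv1_eq_FAIL_of_router_ne {x : TV1} (h : x.router ≠ RouterScore.Outcome.AGREE) : tv1 x = .FAIL := by
  simp [tv1, TV1.holds, h]

/-- (c): at most one counting column ⇒ TV1 fails — so a material with NO band of record (every column `none`) fails
BY CONSTRUCTION, whatever else the map says (S01; the H₃S state of runs #2–#4). [folklore] -/
theorem tv1_eq_FAIL_of_nCounting_le_one {x : TV1} (h : x.nCounting ≤ 1) : tv1 x = .FAIL := by
  have h' : ¬ 2 ≤ x.nCounting := by omega
  simp [tv1, TV1.holds, h']

/-- counting columns are among the columns. [folklore] -/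
theorem TV1.nCounting_le_length (x : TV1) : x.nCounting ≤ x.columns.length := List.countP_le_length
/-- … hence fewer than two truth-SC columns could never pass (§6.1 presupposes the three-pressure request). [folklore] -/
theorem tv1_eq_FAIL_of_length_le_one {x : TV1} (h : x.columns.length ≤ 1) : tv1 x = .FAIL :=
  tv1_eq_FAIL_of_nCounting_le_one ((TV1.nCounting_le_length x).trans h)

/-- (d): a false high-T_c anywhere fails TV1 (S03). [folklore] -/
theorem tv1_eq_FAIL_of_falseHigh {x : TV1} (h : x.noFalseHighTc = false) : tv1 x = .FAIL := by
  simp [tv1, TV1.holds, h]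

/-- (e): a material verdict other than TP fails TV1 (ABSTAIN today; FN would too). [folklore] -/
theorem tv1_eq_FAIL_of_kind_ne {x : TV1} (h : x.kind ≠ Kind.TP) : tv1 x = .FAIL := by
  simp [tv1, TV1.holds, h]

/-! ### The H₃S numbers of record (truth v1.x M08: 150 GPa 203 ± 8 K, 200 GPa 180 ± 15 K, 100 GPa 150 ± 50 K) -/

/-- τ of the three H₃S columns (§2.3 τ = max(err, 1 K, 5 %)): 10.15 K, 15 K, 50 K. [folklore] -/
theorem tau_h3s : CellScore.tau 203 8 = 203 / 20 ∧ CellScore.tau 180 15 = 15 ∧ CellScore.tau 150 50 = 50 := by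
  norm_num [CellScore.tau]

/-- PASS-TV1 (d) limits of record: 266.4375 K @150 GPa, 243.75 K @200, 250 K @100 (S03's SC at 300 K exceeds them). [folklore] -/
theorem falseHighLimit_h3s : falseHighLimit 203 (203 / 20) = 4263 / 16 ∧ falseHighLimit 180 15 = 975 / 4 ∧
    falseHighLimit 150 50 = 250 := by
  norm_num [falseHighLimit]

/-- The §14 / §6.1 EXPECTED-SHAPE columns (deputy-2 TV1 mock: bands [175, 225] K at 150 GPa, [160, 205] K at
200 GPa, none at 100 GPa «undetermined: structure») against the truth of record. [folklore] -/
def h3sExpectedColumns : List Column :=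
  [⟨none, 150, 50⟩, ⟨some (175, 225), 203, 203 / 20⟩, ⟨some (160, 205), 180, 15⟩]

/-- both banded columns COUNT: INSIDE (164.85 ≤ 203 ≤ 235.15; 145 ≤ 180 ≤ 220) with relative half-widths 1/8
and 9/73 ≤ 1/4; the 100-GPa column has no band. [folklore] -/
theorem h3sExpected_counts : h3sExpectedColumns.map Column.counts = [false, true, true] := by
  norm_num [h3sExpectedColumns, Column.counts, CellScore.inside]

/-- The expected-shape H₃S map (well-formed, H-clean, router AGREE, the columns above, no false high-T_c, TP).
[folklore] -/
def h3sExpected : TV1 := ⟨true, true, .AGREE, h3sExpectedColumns, true, .TP⟩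

/-- two of its three columns count. [folklore] -/
theorem h3sExpected_nCounting : h3sExpected.nCounting = 2 := by
  simp only [TV1.nCounting, h3sExpected, List.countP_eq_length_filter]
  norm_num [h3sExpectedColumns, Column.counts, CellScore.inside]

/-- … so it passes PASS-TV1 (= regression scenario S00: the yardstick accepts the §14 expected shape). [folklore] -/
theorem tv1_h3sExpected : tv1 h3sExpected = .PASS := by
  rw [tv1_eq_PASS_iff, TV1.holds_iff, h3sExpected_nCounting]
  exact ⟨rfl, rfl, rfl, le_refl 2, rfl, rfl⟩

/-- TODAY (runs #2–#4 of record: no H₃S band handed in, every cell «undetermined: pending:eph-band / structure»,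
verdict ABSTAIN, router AGREE): the map is honest and FAILS — by (c) and (e), not by any defect. [folklore] -/
def h3sToday : TV1 := ⟨true, true, .AGREE, [⟨none, 150, 50⟩, ⟨none, 203, 203 / 20⟩, ⟨none, 180, 15⟩], true, .ABSTAIN⟩

/-- `h3sToday` fails PASS-TV1 (regression S40/S50/S51 «PASS-TV1 FAIL»). [folklore] -/
theorem tv1_h3sToday : tv1 h3sToday = .FAIL :=
  tv1_eq_FAIL_of_kind_ne (by decide)

/-! ## §2 PASS-TV3 — the controls M30 LK-99 and M32 Cu (ACCEPTANCE §6.3) -/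

/-- A control material's P = 0 column as the scorer and the map report it. [folklore] -/
structure Control where
  /-- W1–W8 clean -/
  wellFormed : Bool
  /-- §4.2 router-word outcome -/
  router : RouterScore.Outcome
  /-- no H1/H2 incident names this map -/
  hClean : Bool
  /-- truth T_floor = T_min_measured of the noSC-down-to column (LK-99 2 K; Cu 10 μK) -/
  Tfloor : ℚ
  /-- the column's cells (T, word) -/
  cells : List (ℚ × Word)
  /-- the column's band(s) (lo, hi); empty if none -/
  bands : List (ℚ × ℚ)
  /-- §4.4 FALSE-BAND count > 0 on this column (band lo above T_min of a non-superconductor) -/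
  falseBand : Bool

/-- the §4.5 verdict kind of a control (truth class: not a known superconductor). [folklore] -/
def Control.kind (c : Control) : Kind := CellScore.kind (CellScore.verdict c.Tfloor c.cells c.bands) false

/-- some cell of the column says «SC». [folklore] -/
def anySC (cells : List (ℚ × Word)) : Bool := cells.any fun x => decide (x.2 = Word.SC)

/-- some band of the column reaches 0.1 K (hi ≥ 1/10). [folklore] -/
def anyBandReaches (bands : List (ℚ × ℚ)) : Bool := bands.any fun b => decide (tenth ≤ b.2)

/-- every cell at T ≥ 0.1 K says «not». [folklore] -/
def allNotFromTenth (cells : List (ℚ × Word)) : Bool :=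
  (CellScore.relevant tenth cells).all fun x => decide (x.2 = Word.not)

/-- PASS-TV3 LK-99: well-formed ∧ no «SC» cell ∧ no band with hi ≥ 0.1 K ∧ verdict TN or ABSTAIN ∧ router word
in the expected set (AGREE) ∧ H-clean. [folklore] -/
def tv3LK99 (c : Control) : Pass :=
  if c.wellFormed && !anySC c.cells && !anyBandReaches c.bands
      && (decide (c.kind = Kind.TN) || decide (c.kind = Kind.ABSTAIN))
      && decide (c.router = RouterScore.Outcome.AGREE) && c.hClean
  then .PASS else .FAIL

/-- PASS-TV3 Cu: well-formed ∧ verdict TN ∧ every T ≥ 0.1 K cell «not» ∧ FALSE-BAND 0 ∧ router AGREE. [folklore] -/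
def tv3Cu (c : Control) : Pass :=
  if c.wellFormed && decide (c.kind = Kind.TN) && allNotFromTenth c.cells && !c.falseBand
      && decide (c.router = RouterScore.Outcome.AGREE)
  then .PASS else .FAIL

/-- an all-«undetermined» column has no «SC» cell. [folklore] -/
theorem anySC_eq_false_of_all_undetermined {cells : List (ℚ × Word)}
    (hu : ∀ x ∈ cells, x.2 = Word.undetermined) : anySC cells = false := by
  rw [anySC, Bool.eq_false_iff, Ne, List.any_eq_true]
  rintro ⟨x, hx, hxs⟩
  rw [decide_eq_true_eq, hu x hx] at hxs
  exact Word.noConfusion hxs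

/-- HONEST ABSTENTION PASSES TV3-LK99: every cell «undetermined» (disputed structure), no band, router AGREE,
H-clean, well-formed ⇒ PASS (the runs #2–#4 state; regression S22/S40/S50/S51). [folklore] -/
theorem tv3LK99_eq_PASS_of_honest {c : Control} (hw : c.wellFormed = true)
    (hr : c.router = RouterScore.Outcome.AGREE) (hh : c.hClean = true) (hb : c.bands = [])
    (hu : ∀ x ∈ c.cells, x.2 = Word.undetermined) : tv3LK99 c = .PASS := by
  have hk : c.kind = Kind.ABSTAIN := by
    simp only [Control.kind, hb, verdict_of_all_undetermined hu, CellScore.kind]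
  simp [tv3LK99, hw, hr, hh, hb, hk, anySC_eq_false_of_all_undetermined hu, anyBandReaches]

/-- ANY «SC» CELL FAILS TV3-LK99 at any confidence (S20: the 2023 claim as a map). [folklore] -/
theorem tv3LK99_eq_FAIL_of_SC_cell {c : Control} (h : ∃ x ∈ c.cells, x.2 = Word.SC) : tv3LK99 c = .FAIL := by
  have hsc : anySC c.cells = true :=
    List.any_eq_true.mpr (by obtain ⟨x, hx, hxs⟩ := h; exact ⟨x, hx, by simpa using hxs⟩)
  simp [tv3LK99, hsc]

/-- A band reaching 0.1 K fails TV3-LK99. [folklore] -/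
theorem tv3LK99_eq_FAIL_of_band {c : Control} (h : ∃ b ∈ c.bands, tenth ≤ b.2) : tv3LK99 c = .FAIL := by
  have hb : anyBandReaches c.bands = true :=
    List.any_eq_true.mpr (by obtain ⟨b, hb, hbs⟩ := h; exact ⟨b, hb, by simpa using hbs⟩)
  simp [tv3LK99, hb]

/-- CU'S HONEST ABSTENTION FAILS TV3-Cu BY CONSTRUCTION: every cell «undetermined» (pending:eph-band) and no band ⇒
verdict UNDETERMINED ⇒ kind ABSTAIN ≠ TN (runs #2–#4; regression S40/S50/S51 «TV3-Cu FAIL») — the clause waits for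
the e–ph «not» words; it does not accuse the map. [folklore] -/
theorem tv3Cu_eq_FAIL_of_all_undetermined {c : Control} (hb : c.bands = [])
    (hu : ∀ x ∈ c.cells, x.2 = Word.undetermined) : tv3Cu c = .FAIL := by
  have hk : c.kind = Kind.ABSTAIN := by
    simp only [Control.kind, hb, verdict_of_all_undetermined hu, CellScore.kind]
  simp [tv3Cu, hk]

/-- TV3-Cu needs the verdict TN: any other kind fails. [folklore] -/
theorem tv3Cu_eq_FAIL_of_kind_ne {c : Control} (h : c.kind ≠ Kind.TN) : tv3Cu c = .FAIL := by
  simp [tv3Cu, h]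

/-- TV3-Cu PASSES on: well-formed, verdict TN, every T ≥ 0.1 K cell «not», no false band, router AGREE. [folklore] -/
theorem tv3Cu_eq_PASS_of {c : Control} (hw : c.wellFormed = true) (hk : c.kind = Kind.TN)
    (hn : allNotFromTenth c.cells = true) (hf : c.falseBand = false)
    (hr : c.router = RouterScore.Outcome.AGREE) : tv3Cu c = .PASS := by
  simp [tv3Cu, hw, hk, hn, hf, hr]

/-- Neither control can PASS with an FP verdict (either control called SC ⇒ §4.5 names it; here TV3 fails).
[folklore] -/
theorem tv3_eq_FAIL_of_FP {c : Control} (h : c.kind = Kind.FP) : tv3LK99 c = .FAIL ∧ tv3Cu c = .FAIL := by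
  constructor
  · simp [tv3LK99, h]
  · simp [tv3Cu, h]

/-! ### The control shapes of §14, on the sub-grid {0, 0.1, 1, 10, 100, 300} K of T22 (six cells for brevity;
the T22 versions are the regression scenarios S00/S20/S21/S22) -/

/-- a six-point sub-grid of the validation temperature grid T22, in K. [folklore] -/
def tGrid : List ℚ := [0, tenth, 1, 10, 100, 300]

/-- a column wording every grid cell with the same word. [folklore] -/
def uniformColumn (w : Word) : List (ℚ × Word) := tGrid.map fun T => (T, w)

/-- every cell of a uniform column carries that word. [folklore] -/
theorem uniformColumn_word {w : Word} : ∀ x ∈ uniformColumn w, x.2 = w := by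
  intro x hx
  simp only [uniformColumn, List.mem_map] at hx
  obtain ⟨T, _, rfl⟩ := hx
  rfl

/-- LK-99 TODAY (runs #2–#4): every cell «undetermined: disputed», no band, router UND:DISPUTED AGREE, T_min 2 K.
[folklore] -/
def lk99Today : Control := ⟨true, .AGREE, true, 2, uniformColumn .undetermined, [], false⟩

/-- LK-99 AS CLAIMED IN 2023 (regression S20): «SC» everywhere below a band [380, 410] K, router EPH DISAGREE.
[folklore] -/
def lk99Claim : Control := ⟨true, .DISAGREE, true, 2, uniformColumn .SC, [(380, 410)], false⟩

/-- Cu TODAY (runs #2–#4): every cell «undetermined: pending:eph-band», no band, router EPH AGREE, T_min 10 μK.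
[folklore] -/
def cuToday : Control := ⟨true, .AGREE, true, 1 / 100000, uniformColumn .undetermined, [], false⟩

/-- Cu AS §14 EXPECTS IT: T ≥ 0.1 K «not», T = 0 «undetermined» (unscored), band [0, 1 mK], router AGREE.
[folklore] -/
def cuExpected : Control :=
  ⟨true, .AGREE, true, 1 / 100000,
    [(0, .undetermined), (tenth, .not), (1, .not), (10, .not), (100, .not), (300, .not)], [(0, 1 / 1000)], false⟩

/-- LK-99 today PASSES PASS-TV3 (honest abstention, counted). [folklore] -/
theorem tv3LK99_today : tv3LK99 lk99Today = .PASS :=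
  tv3LK99_eq_PASS_of_honest rfl rfl rfl rfl uniformColumn_word

/-- the 2023 claim as a map FAILS PASS-TV3 (an «SC» cell; also router DISAGREE). [folklore] -/
theorem tv3LK99_claim : tv3LK99 lk99Claim = .FAIL :=
  tv3LK99_eq_FAIL_of_SC_cell ⟨(0, Word.SC), by simp [lk99Claim, uniformColumn, tGrid], rfl⟩

/-- Cu today FAILS PASS-TV3-Cu (by construction: ABSTAIN ≠ TN). [folklore] -/
theorem tv3Cu_today : tv3Cu cuToday = .FAIL :=
  tv3Cu_eq_FAIL_of_all_undetermined rfl uniformColumn_word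

/-- Cu as §14 expects it has verdict NOT (no «SC», band [0, 1 mK] decides nothing, every T ≥ 10 μK cell «not»)
⇒ kind TN … [folklore] -/
theorem cuExpected_kind : cuExpected.kind = Kind.TN := by
  decide +kernel

/-- … and PASSES PASS-TV3-Cu. [folklore] -/
theorem tv3Cu_expected : tv3Cu cuExpected = .PASS :=
  tv3Cu_eq_PASS_of rfl cuExpected_kind (by decide +kernel) rfl rfl

end WorkedExample

end Summit.Ventures.CertifiedManyBodySolver.Downfold
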